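import Summits.ResolutionOfSingularities.ResolutionOfSingularities.Theorems.MarkedTransferCampaignW46MohWindowShadeStallWalk
import Summits.ResolutionOfSingularities.ResolutionOfSingularities.Theorems.MarkedTransferCampaignW46MohWindowShadeDigits
import Mathlib.Order.WellFounded
import HarnessLib

/-!
# [OURS · L1 W4.6] Rung (iii) "Moh window", SURFACES — the SHAPE of an infinite in-window walk: a coordinate `p`-th
  power or a DIGIT PHASE

Cell `res-hironaka`, rung L, slot W4.6, seat `res-L1-s46-pv-6` (gen 3).  Sharpening of `…MohWindowShadeStallWalk` /
`…MohWindowShadeTermination` (same proof, stronger conclusion kept explicit): along every INFINITE walk of equimultiple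
point blow-ups of `x^p + F(y_j, y_i)` presented in the Hauser–Wagner frame and staying in the window, at some stage `n`
EITHER `y_l^p` divides every monomial of `F_n` (a coordinate `p`-fold curve), OR the walk enters a DIGIT PHASE: from `n`
on every step is read in the chart `y_j`, `y_i` is never exceptional again, and the order is constant
(`phase_of_stall_walk`, `phase_of_walk`).  In a digit phase the run formula with explicit digits
(`…MohWindowShadeDigits.formal_pth_power_of_run_digits`) gives, for EVERY `k`, `F_n ≡ (y_i − ψ_k(y_j))^p · w_k` modulo
degree `≥ ord F_n + k` with `ψ_k = Σ_{k'<k} t_{n+k'} y_j^{k'+1}` the truncations of ONE formal power series — the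
canonical formal `p`-fold branch the walk follows (`formal_branch_of_walk`).  This is the form of the termination theorem
from which a power-series factorisation `F_n = h^p · W` in `K[[y_j, y_i]]` can be read off.  OURS; replaces — for
regime (iii) of RESCUE-SEED W4.6, the classical pair, surfaces — the ROLE of the termination clause of Th. 16.13 (ms.
p. 87 l. 25–29); NOT a statement of the manuscript [claim: Hironaka2017, status: under-review], nothing of which is used.
AI review is weaker than expert review.
-/

noncomputable section

set_option linter.dupNamespace false -- mandated namespace of this single-conjunct summit

open MvPolynomial Finset

namespace Summit.ResolutionOfSingularities.ResolutionOfSingularities.Theorems.CampaignW46.MohWindowShadePhase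

open Literature.AlgebraicGeometry.Resolution
open Literature.AlgebraicGeometry.Resolution.PointBlowup
open Literature.AlgebraicGeometry.Resolution.Hauser2010
open Literature.Barriers.ResolutionOfSingularities (ordZero_le_of_coeff_ne_zero le_ordZero_of_forall)
open MohWindowShadeCleaning (eq_single_add_single degree_eq_add)
open MohWindowShadeStallWalk (degree_r_le degree_step_r univ_erase_eq_singleton invariants_of_walk)

variable {σ : Type*} {K : Type*} [Field K] [Fintype σ] [DecidableEq σ] [DecidableEq K]
variable (p : ℕ) [hp : Fact p.Prime] [CharP K p]

section TwoLetters

variable {j i : σ}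

/-- **[OURS · L1 W4.6] SURFACES: THE SHAPE OF AN INFINITE STALL WALK — a coordinate `p`-th power, or a DIGIT PHASE.**
Same hypotheses as `MohWindowShadeStallWalk.exists_formal_curve_of_stall_walk` (infinite walk in the Hauser–Wagner frame,
cleaned start, `y^r ∣ F`, equimultiple steps, window at every stage, no step drops the shade), SHARPER CONCLUSION: at some
stage `n` EITHER every monomial of `F_n` is divisible by `y_l^p` for a letter `l` (the coordinate `p`-fold curve
`y_l = 0`), OR from `n` on the walk is a DIGIT PHASE: every later step is read in the chart `y_j`, the letter `y_i` is
never exceptional again (`r_i = 0`), and the order is constant — the situation in which the run formula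
(`…RunFormula`, `…Digits`) exhibits `F_n` as the `p`-th power of the formal branch `y_i = Σ_k t_{n+k} y_j^{k+1}` times a
cofactor to every order.  NOT a statement of the manuscript. [folklore] -/
theorem phase_of_stall_walk (hij : i ≠ j) (htwo : ∀ l, l = j ∨ l = i) (s : ℕ → State σ K)
    (c : ℕ → σ) (b : ℕ → σ → K) (hb : ∀ n, b n (c n) = 0) (hHW : ∀ n, c n = i → ∀ l, b n l = 0)
    (hstep : ∀ n, s (n + 1) = step p (c n) (b n) (s n))
    (hclean : deletePthPowers p (s 0).F = (s 0).F) (hr : ∀ d ∈ (s 0).F.support, (s 0).r ≤ d)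
    (heq : ∀ n, IsEquimultiplePoint p (c n) (b n) (s n))
    (hwin : ∀ n, (p : ℕ∞) ≤ ordZero (s n).F ∧ ordZero (s n).F < (2 * p : ℕ))
    (hstall : ∀ n, ¬ ShadeDrops p (c n) (b n) (s n)) :
    ∃ n, (∃ l, ∀ d ∈ (s n).F.support, p ≤ d l) ∨
      ((∀ k, c (n + k) = j) ∧ (∀ k, (s (n + k)).r i = 0) ∧ (∀ k, ordZero (s (n + k)).F = ordZero (s n).F)) := by
  classical
  -- §a invariants
  have hinv := invariants_of_walk p hij htwo s c b hb hstep hclean hr heq hwin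
  choose o ho hlo hhi using fun n => (hinv n).2.2
  have hcl : ∀ n, deletePthPowers p (s n).F = (s n).F := fun n => (hinv n).1
  have hrn : ∀ n, ∀ d ∈ (s n).F.support, (s n).r ≤ d := fun n => (hinv n).2.1
  have hrle : ∀ n, (s n).r.degree ≤ o n := fun n => degree_r_le (s n) (ho n) (hrn n)
  have hdeg : ∀ n, ∀ d ∈ (s n).F.support, p ≤ d.degree :=
    fun n d hd => le_trans (hlo n).le (le_degree_of_ordZero_eq (s n) (ho n) d hd)
  have hstepj : ∀ n, c n = j → s (n + 1) = step p j (b n) (s n) := fun n h => by rw [hstep n, h]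
  have hbj' : ∀ n, c n = j → b n j = 0 := fun n h => by rw [← h]; exact hb n
  -- §b the constant shade `A`: `o n = |r n| + A`
  have hshade : ∀ n, (s n).shade = ((o n - (s n).r.degree : ℕ) : ℕ∞) :=
    fun n => shade_eq_of_ordZero_eq (s n) (ho n)
  have hconst : ∀ n, o (n + 1) - (s (n + 1)).r.degree = o n - (s n).r.degree := by
    intro n
    have hle : (s (n + 1)).shade ≤ (s n).shade := by
      rw [hstep n]
      exact MohWindowShade.shade_step_le_of_lt_two_mul p (c n) (b n) (hb n) (s n) (hcl n) (ho n)
        (hlo n).le (hhi n) (hrn n) (heq n)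
    have hge : ¬ (s (n + 1)).shade < (s n).shade := by
      have := hstall n
      unfold ShadeDrops at this
      rwa [← hstep n] at this
    have heq' : (s (n + 1)).shade = (s n).shade := le_antisymm hle (not_lt.mp hge)
    rw [hshade, hshade] at heq'
    exact_mod_cast heq'
  set A := o 0 - (s 0).r.degree with hA
  have hA' : ∀ n, o n = (s n).r.degree + A := by
    intro n
    induction n with
    | zero => have := hrle 0; omega
    | succ n ih => have := hconst n; have := hrle (n + 1); have := hrle n; omega
  by_cases hA0 : A = 0
  · -- §c shade zero: the terminal case of gen 2
    by_cases hprop : ∃ l, p ≤ (s 0).r l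
    · obtain ⟨l, hl⟩ := hprop
      exact ⟨0, Or.inl ⟨l, fun d hd => le_trans hl (Finsupp.le_def.mp (hr d hd) l)⟩⟩
    · push Not at hprop
      exfalso
      have hnpc : ∀ k, ∑ l ∈ univ.erase k, (s 0).r l < p := by
        intro k
        rcases htwo k with hk | hk
        · rw [hk, univ_erase_eq_singleton hij htwo, Finset.sum_singleton]; exact hprop i
        · have htwo' : ∀ l, l = i ∨ l = j := fun l => (htwo l).symm
          rw [hk, univ_erase_eq_singleton hij.symm htwo', Finset.sum_singleton]; exact hprop j
      have hordr : ordZero (s 0).F = ((s 0).r.degree : ℕ) := by rw [ho 0, hA' 0, hA0, add_zero]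
      have hlo0 : p < (s 0).r.degree := by have := hlo 0; rw [hA' 0, hA0] at this; omega
      have hhi0 : (s 0).r.degree < 2 * p := by have := hhi 0; rw [hA' 0, hA0] at this; omega
      have h := MohWindowShadeTerminal.length_le_of_noProperCentre p s c b hb hstep hclean hr hordr hlo0
        hhi0 hnpc (N := (s 0).r.degree) (fun n _ => heq n)
      omega
  · -- §d positive shade
    have hApos : 1 ≤ A := Nat.one_le_iff_ne_zero.mpr hA0
    -- a stall in the chart `y_j` makes the next state adapted
    have hadapt : ∀ n, c n = j →
        ∃ E ∈ (s (n + 1)).F.support, E.degree = o (n + 1) ∧ (s (n + 1)).r i < E i := by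
      intro n hcn
      have hstalln : ¬ ShadeDrops p j (b n) (s n) := by
        have := hstall n; rw [hcn] at this; exact this
      have hAn : o n - (s n).r.degree = A := by have := hA' n; omega
      by_cases hbi : b n i = 0
      · have hb0 : ∀ l, b n l = 0 := fun l => by
          rcases htwo l with rfl | rfl
          · exact hbj' n hcn
          · exact hbi
        obtain ⟨E, hE, hEj, hEi⟩ := MohWindowShadeAdapted.exists_adapted_of_stall_origin p hij htwo (b n)
          hb0 (s n) (hcl n) (ho n) (hlo n) (hhi n) (hrn n) hstalln
        rw [← hstepj n hcn] at hE hEj hEi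
        refine ⟨E, hE, ?_, ?_⟩
        · rw [degree_eq_add hij htwo E, hEj, hEi, hA' (n + 1),
            degree_eq_add hij htwo (s (n + 1)).r, hAn]
          ring
        · rw [hEi, hAn]; omega
      · have hE := MohWindowShadeAdapted.mem_support_step_of_stall_translate p hij htwo (b n)
          (hbj' n hcn) hbi (s n) (ho n) (hlo n) (hhi n) (hrn n) hstalln
        rw [← hstepj n hcn] at hE
        have hr' : (s (n + 1)).r.degree = o n - p := by
          rw [hstepj n hcn, degree_step_r p hij htwo (b n) (hbj' n hcn) (s n) (ho n), if_neg hbi,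
            add_zero]
        have hri' : (s (n + 1)).r i = 0 := by
          rw [hstepj n hcn, MohWindowShadeTerminal.step_r_apply p j (b n) (hbj' n hcn) (s n) (ho n) i,
            if_neg hbi]
        refine ⟨_, hE, ?_, ?_⟩
        · rw [map_add, Finsupp.degree_single, Finsupp.degree_single, hA' (n + 1), hr', hAn]
        · rw [hri', Finsupp.add_apply, Finsupp.single_eq_of_ne hij, Finsupp.single_eq_same, zero_add,
            hAn]
          omega
    -- no vertical stall from an adapted state
    have hnoV : ∀ n, (∃ E ∈ (s n).F.support, E.degree = o n ∧ (s n).r i < E i) → c n = j := by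
      rintro n ⟨E, hE, hEdeg, hEi⟩
      rcases htwo (c n) with h | h
      · exact h
      · exfalso
        have hb0 : b n = 0 := funext (hHW n h)
        have hdrop := MohWindowShadeAdapted.shadeDrops_vertical_of_adapted p (s n) (ho n) (hlo n)
          (hhi n) (hrn n) hE hEdeg hEi
        apply hstall n
        rw [h, hb0]
        exact hdrop
    -- persistence of the chart `y_j`
    have hpers : ∀ n, c n = j → ∀ k, c (n + k) = j := by
      intro n hcn k
      induction k with
      | zero => rw [add_zero]; exact hcn
      | succ k ih => exact hnoV (n + k + 1) (hadapt (n + k) ih)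
    by_cases hI : ∃ n₁, c n₁ = j
    · obtain ⟨n₁, hn₁⟩ := hI
      have hcj : ∀ n, n₁ ≤ n → c n = j := by
        intro n hn
        obtain ⟨k, rfl⟩ := Nat.exists_eq_add_of_le hn
        exact hpers n₁ hn₁ k
      by_cases hIa : ∃ n₂, n₁ ≤ n₂ ∧ b n₂ i ≠ 0
      · -- §e a translated stall at `n₂`: afterwards `r_i = 0` and `o_{n+1} + p = o_n + A`
        obtain ⟨n₂, hn₁₂, hbn₂⟩ := hIa
        have hri : ∀ k, (s (n₂ + 1 + k)).r i = 0 := by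
          intro k
          induction k with
          | zero =>
            rw [add_zero, hstepj n₂ (hcj n₂ hn₁₂), MohWindowShadeTerminal.step_r_apply p j (b n₂)
              (hbj' n₂ (hcj n₂ hn₁₂)) (s n₂) (ho n₂) i, if_neg hbn₂]
          | succ k ih =>
            have hc' : c (n₂ + 1 + k) = j := hcj _ (by omega)
            rw [show n₂ + 1 + (k + 1) = n₂ + 1 + k + 1 by omega, hstepj _ hc',
              MohWindowShadeTerminal.step_r_apply p j (b _) (hbj' _ hc') (s _) (ho _) i, if_neg hij, ih]
            split_ifs <;> rfl
        have hodyn : ∀ k, o (n₂ + 1 + k + 1) + p = o (n₂ + 1 + k) + A := by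
          intro k
          have hc' : c (n₂ + 1 + k) = j := hcj _ (by omega)
          have h1 := hA' (n₂ + 1 + k + 1)
          have h2 : (s (n₂ + 1 + k + 1)).r.degree = o (n₂ + 1 + k) - p := by
            rw [hstepj _ hc', degree_step_r p hij htwo (b _) (hbj' _ hc') (s _) (ho _), hri k]
            split_ifs <;> rfl
          have h3 := hlo (n₂ + 1 + k)
          omega
        rcases Nat.lt_trichotomy A p with hAp | hAp | hAp
        · -- `A < p`: the order decreases for ever
          exfalso
          have hdec : ∀ k, o (n₂ + 1 + k) + k ≤ o (n₂ + 1) := by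
            intro k
            induction k with
            | zero => rw [add_zero, add_zero]
            | succ k ih =>
              have := hodyn k
              rw [show n₂ + 1 + (k + 1) = n₂ + 1 + k + 1 by omega]
              omega
          have := hdec (o (n₂ + 1) + 1)
          omega
        · -- `A = p`: a digit phase
          have hO : ∀ k, o (n₂ + 1 + k) = o (n₂ + 1) := by
            intro k
            induction k with
            | zero => rw [add_zero]
            | succ k ih =>
              have := hodyn k
              rw [show n₂ + 1 + (k + 1) = n₂ + 1 + k + 1 by omega]
              omega
          exact ⟨n₂ + 1, Or.inr ⟨fun k => hcj _ (by omega), hri, fun k => by rw [ho, ho, hO k]⟩⟩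
        · -- `p < A`: the order increases for ever, against the window
          exfalso
          have hinc : ∀ k, o (n₂ + 1) + k ≤ o (n₂ + 1 + k) := by
            intro k
            induction k with
            | zero => rw [add_zero, add_zero]
            | succ k ih =>
              have := hodyn k
              rw [show n₂ + 1 + (k + 1) = n₂ + 1 + k + 1 by omega]
              omega
          have h1 := hinc (2 * p)
          have h2 := hhi (n₂ + 1 + 2 * p)
          omega
      · -- §f no translated move after `n₁`: an origin run in the chart `y_j`
        push Not at hIa
        have hb0 : ∀ n, n₁ ≤ n → b n = 0 := fun n hn => funext fun l => by
          rcases htwo l with rfl | rfl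
          · exact hbj' n (hcj n hn)
          · exact hIa n hn
        have hrun := MohWindowShadeAdapted.forall_le_sum_of_origin_run p j (fun k => s (n₁ + k))
          (fun k => by
            show s (n₁ + (k + 1)) = step p j 0 (s (n₁ + k))
            rw [show n₁ + (k + 1) = n₁ + k + 1 by omega, hstep, hcj _ (by omega), hb0 _ (by omega)])
          (hcl n₁) (fun k => hdeg (n₁ + k))
        refine ⟨n₁, Or.inl ⟨i, fun d hd => ?_⟩⟩
        have := hrun d hd
        rwa [univ_erase_eq_singleton hij htwo, Finset.sum_singleton] at this
    · -- §g every move is vertical: an origin run in the chart `y_i` from the start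
      push Not at hI
      have hci : ∀ n, c n = i := fun n => by
        rcases htwo (c n) with h | h
        · exact absurd h (hI n)
        · exact h
      have hb0 : ∀ n, b n = 0 := fun n => funext (hHW n (hci n))
      have hrun := MohWindowShadeAdapted.forall_le_sum_of_origin_run p i s
        (fun n => by rw [hstep n, hci n, hb0 n]) hclean hdeg
      refine ⟨0, Or.inl ⟨j, fun d hd => ?_⟩⟩
      have := hrun d hd
      have htwo' : ∀ l, l = i ∨ l = j := fun l => (htwo l).symm
      rwa [univ_erase_eq_singleton hij.symm htwo', Finset.sum_singleton] at this

/-- **[OURS · L1 W4.6] SURFACES: THE SHAPE OF EVERY INFINITE IN-WINDOW WALK — a coordinate `p`-th power, or a DIGIT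
PHASE.**  Hypotheses of `MohWindowShadeTermination.exists_formal_curve_of_walk` (no stall hypothesis: the shade is
eventually constant by gen 0's no-increase law); conclusion of `phase_of_stall_walk`.  NOT a statement of the manuscript.
[folklore] -/
theorem phase_of_walk (hij : i ≠ j) (htwo : ∀ l, l = j ∨ l = i) (s : ℕ → State σ K)
    (c : ℕ → σ) (b : ℕ → σ → K) (hb : ∀ n, b n (c n) = 0) (hHW : ∀ n, c n = i → ∀ l, b n l = 0)
    (hstep : ∀ n, s (n + 1) = step p (c n) (b n) (s n))
    (hclean : deletePthPowers p (s 0).F = (s 0).F) (hr : ∀ d ∈ (s 0).F.support, (s 0).r ≤ d)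
    (heq : ∀ n, IsEquimultiplePoint p (c n) (b n) (s n))
    (hwin : ∀ n, (p : ℕ∞) ≤ ordZero (s n).F ∧ ordZero (s n).F < (2 * p : ℕ)) :
    ∃ n, (∃ l, ∀ d ∈ (s n).F.support, p ≤ d l) ∨
      ((∀ k, c (n + k) = j) ∧ (∀ k, (s (n + k)).r i = 0) ∧ (∀ k, ordZero (s (n + k)).F = ordZero (s n).F)) := by
  classical
  have hinv := invariants_of_walk p hij htwo s c b hb hstep hclean hr heq hwin
  choose o ho hlo hhi using fun n => (hinv n).2.2
  have hcl : ∀ n, deletePthPowers p (s n).F = (s n).F := fun n => (hinv n).1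
  have hrn : ∀ n, ∀ d ∈ (s n).F.support, (s n).r ≤ d := fun n => (hinv n).2.1
  have hshade : ∀ n, (s n).shade = ((o n - (s n).r.degree : ℕ) : ℕ∞) :=
    fun n => shade_eq_of_ordZero_eq (s n) (ho n)
  set a : ℕ → ℕ := fun n => o n - (s n).r.degree with ha
  have hsucc : ∀ n, a (n + 1) ≤ a n := by
    intro n
    have hle : (s (n + 1)).shade ≤ (s n).shade := by
      rw [hstep n]
      exact MohWindowShade.shade_step_le_of_lt_two_mul p (c n) (b n) (hb n) (s n) (hcl n) (ho n)
        (hlo n).le (hhi n) (hrn n) (heq n)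
    rw [hshade, hshade] at hle
    exact_mod_cast hle
  have hanti : Antitone a := antitone_nat_of_succ_le hsucc
  set n₀ := Function.argmin a with hn₀
  have hmin : ∀ n, a n₀ ≤ a n := fun n => not_lt.mp (Function.not_lt_argmin a n)
  have hstall : ∀ k, ¬ ShadeDrops p (c (n₀ + k)) (b (n₀ + k)) (s (n₀ + k)) := by
    intro k hdrop
    unfold ShadeDrops at hdrop
    rw [← hstep, hshade, hshade] at hdrop
    have h1 : a (n₀ + k + 1) < a (n₀ + k) := by exact_mod_cast hdrop
    have h2 := hmin (n₀ + k + 1)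
    have h3 := hanti (show n₀ ≤ n₀ + k by omega)
    exact absurd (lt_of_lt_of_le h1 h3) (not_lt.mpr h2)
  obtain ⟨n, hn⟩ := phase_of_stall_walk p hij htwo (fun k => s (n₀ + k))
    (fun k => c (n₀ + k)) (fun k => b (n₀ + k)) (fun k => hb (n₀ + k)) (fun k => hHW (n₀ + k))
    (fun k => by
      show s (n₀ + (k + 1)) = step p (c (n₀ + k)) (b (n₀ + k)) (s (n₀ + k))
      rw [show n₀ + (k + 1) = n₀ + k + 1 by omega]
      exact hstep (n₀ + k))
    (hcl n₀) (hrn n₀) (fun k => heq (n₀ + k)) (fun k => hwin (n₀ + k)) hstall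
  refine ⟨n₀ + n, ?_⟩
  rcases hn with h | ⟨h1, h2, h3⟩
  · exact Or.inl h
  · refine Or.inr ⟨fun k => ?_, fun k => ?_, fun k => ?_⟩
    · have := h1 k; rwa [add_assoc]
    · have := h2 k; rwa [add_assoc]
    · have := h3 k; rwa [add_assoc]

/-- **[OURS · L1 W4.6] SURFACES: EVERY INFINITE IN-WINDOW WALK FOLLOWS A CANONICAL FORMAL `p`-FOLD BRANCH.**  Along
every infinite walk as in `phase_of_walk`, at some stage `n`: either `y_l^p ∣ F_n` monomialwise (a coordinate `p`-fold
curve), or for EVERY `k` the residual polynomial satisfies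
`F_n ≡ (y_i − Σ_{k'<k} t_{n+k'}·y_j^{k'+1})^p · w_k` modulo monomials of degree `≥ ord F_n + k`, where
`t_m = b m i` are the POINTS OF THE WALK itself: the truncations of the single formal power series
`ψ = Σ_{k'} t_{n+k'} y_j^{k'+1}` — the walk reads off, digit by digit, the formal smooth branch `y_i = ψ(y_j)` of which
`F_n` is formally a `p`-th power multiple.  NOT a statement of the manuscript. [folklore] -/
theorem formal_branch_of_walk (hij : i ≠ j) (htwo : ∀ l, l = j ∨ l = i) (s : ℕ → State σ K)
    (c : ℕ → σ) (b : ℕ → σ → K) (hb : ∀ n, b n (c n) = 0) (hHW : ∀ n, c n = i → ∀ l, b n l = 0)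
    (hstep : ∀ n, s (n + 1) = step p (c n) (b n) (s n))
    (hclean : deletePthPowers p (s 0).F = (s 0).F) (hr : ∀ d ∈ (s 0).F.support, (s 0).r ≤ d)
    (heq : ∀ n, IsEquimultiplePoint p (c n) (b n) (s n))
    (hwin : ∀ n, (p : ℕ∞) ≤ ordZero (s n).F ∧ ordZero (s n).F < (2 * p : ℕ)) :
    ∃ n, (∃ l, ∀ d ∈ (s n).F.support, p ≤ d l) ∨
      ∀ k, ∃ w : MvPolynomial σ K, ordZero (s n).F + k ≤
        ordZero ((s n).F - (X i - ∑ k' ∈ Finset.range k, C (b (n + k') i) * X j ^ (k' + 1)) ^ p * w) := by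
  classical
  obtain ⟨n, hn⟩ := phase_of_walk p hij htwo s c b hb hHW hstep hclean hr heq hwin
  refine ⟨n, ?_⟩
  rcases hn with h | ⟨hcj, -, hord⟩
  · exact Or.inl h
  · right
    intro k
    have hinv := invariants_of_walk p hij htwo s c b hb hstep hclean hr heq hwin
    obtain ⟨o, ho, hlo, -⟩ := (hinv n).2.2
    have hbj : ∀ k', b (n + k') j = 0 := fun k' => by have := hb (n + k'); rwa [hcj k'] at this
    obtain ⟨w, hw⟩ := MohWindowShadeDigits.formal_pth_power_of_run_digits p hij htwo (fun k' => s (n + k'))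
      (fun k' => b (n + k')) hbj
      (fun k' => by
        show s (n + (k' + 1)) = step p j (b (n + k')) (s (n + k'))
        rw [show n + (k' + 1) = n + k' + 1 by omega, hstep, hcj k'])
      (hinv n).1
      (fun k' d hd => by
        obtain ⟨o', ho', hlo', -⟩ := (hinv (n + k')).2.2
        exact le_trans hlo'.le (le_degree_of_ordZero_eq (s (n + k')) ho' d hd))
      k (o := o) (fun d hd => by
        have ho' : ordZero (s (n + k)).F = o := by rw [hord k, ho]
        exact le_degree_of_ordZero_eq (s (n + k)) ho' d hd)
    refine ⟨w, ?_⟩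
    rw [ho]
    exact_mod_cast hw

end TwoLetters

end Summit.ResolutionOfSingularities.ResolutionOfSingularities.Theorems.CampaignW46.MohWindowShadePhase
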